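import Literature.Analysis.FluidPDE.TorusClassicalNSH3Smoothing
import Summits.AnomalousDissipation.AnomalousDissipation.Theorems.BaireTransferDenseLoudDesignerForcesErgodicH2Smoothing

/-!
# Uniform `H³` and `W^{1,∞}` bounds along an NS phase after a time lapse (block N1, `m = 3`, of stub
# `stub_smoothModel`, line `ergodic-budget-selection-closing`, crux `BaireTransfer.DenseLoudDesignerForces`,
# stmt-AnomalousDissipation-1143)

Summit-side corollaries of the Literature `H³` smoothing estimate
`Torus.IsClassicalNSSolutionOn.gradNormSq_laplacian_le_of_le` (`Literature/Analysis/FluidPDE/TorusClassicalNSH3Smoothing.lean`)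
for the line vocabulary `IsNSPhase` (`…ErgodicLine.lean`), chained after the `H²` step of
`…ErgodicH2Smoothing.lean`: along an NS phase `(K, φ)` of a steady force `F` at viscosity `ν > 0`, for every `τ > 0`,

* `IsNSPhase.exists_forall_gradNormSq_laplacian_le` — there is `C` with `‖∇Δu(t)‖₂² ≤ C` for every `x ∈ K`, every
  classical trajectory `(u, p)` of `x` and every `t ≥ τ`: the sets `φ_t(K)`, `t ≥ τ`, hence `K_∞ = ⋂ₙ φₙ(K)`, are
  bounded in `H³`;
* `IsNSPhase.exists_forall_norm_partialDeriv_le` — there is `M₁` with `‖∂ₖu(t, y)‖ ≤ M₁` for `t ≥ τ`: the coefficient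
  bounds `‖∂ᵢu‖ ≤ Cᵢ` (with `∑ᵢ Cᵢ ≤ 3M₁`) of the `H → V` smoothing estimates of the linearised and difference equations
  (`Torus.linearisedNS_sub_mul_gradNormSq_le`, p118989; `Torus.IsClassicalNSSolutionOn.sub_mul_gradNormSq_sub_le`,
  p119110), and the `W^{1,∞}` bound of the reference orbit in the `L²`-Lipschitz estimate
  `Torus.IsClassicalNSSolutionOn.integral_norm_sub_sq_le_mul_exp` used by the decoding step.

References: Robinson–Rodrigo–Sadowski, *The Three-Dimensional Navier–Stokes Equations* (CUP 2016) Thm 7.1, 7.5;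
Constantin–Foias, *Navier–Stokes Equations* (1988) Thm 10.6.
-/

-- `Summit.<Summit>.<Problem>` is the tree's mandated summit-side namespace (CONVENTIONS §2); for this
-- single-conjunct summit the two coincide, so the duplicate is deliberate.
set_option linter.dupNamespace false

noncomputable section

open scoped BigOperators Topology ENNReal InnerProductSpace
open Filter Set Function MeasureTheory

namespace Summit.AnomalousDissipation.AnomalousDissipation.Theorems.DenseLoudDesignerForces.Ergodic

open Literature.Analysis.FunctionSpaces Literature.Analysis.FunctionSpaces.Torus
open Literature.Analysis.FluidPDE Literature.Analysis.FluidPDE.Torus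
open Summit.AnomalousDissipation.AnomalousDissipation.Theses.BaireTransfer
open Summit.AnomalousDissipation.AnomalousDissipation.Theorems.DenseLoudDesignerForces.Negative

variable {ν : ℝ} {F : (UnitAddTorus (Fin 3)) → (EuclideanSpace ℝ (Fin 3))} {K : Set Hsp} {φ : ℝ → Hsp → Hsp}

/-- **Uniform `H³` bound along an NS phase after a time lapse** (parabolic smoothing, Robinson–Rodrigo–Sadowski 2016
Thm 7.1/7.5 in the quantitative form `Torus.IsClassicalNSSolutionOn.gradNormSq_laplacian_le_of_le`): for an NS phase
`(K, φ)` of the steady force `F` at viscosity `ν > 0` and every `τ > 0` there is `C` such that for every `x ∈ K`, every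
classical trajectory `(u, p)` of `x` and every `t ≥ τ`, `‖∇Δu(t)‖₂² ≤ C`.  Proof: on `[t − τ/2, t]` the slices have
zero mean, enstrophy `≤ E₁` (`exists_forall_gradNormSq_le`) and, the window starting at time `≥ τ/2`, `∫‖Δu‖² ≤ Y₁`
(`exists_forall_integral_norm_laplacian_sq_le` with lapse `τ/2`); the force is constant.
[cite: RobinsonRodrigoSadowskiCUP2016, Thm 7.1 and Thm 7.5] -/
theorem IsNSPhase.exists_forall_gradNormSq_laplacian_le (hν : 0 < ν) (hK : IsNSPhase ν F K φ)
    {τ : ℝ} (hτ : 0 < τ) :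
    ∃ C : ℝ, ∀ x ∈ K, ∀ (u : ℝ → (UnitAddTorus (Fin 3)) → (EuclideanSpace ℝ (Fin 3))) (p : ℝ → (UnitAddTorus (Fin 3)) → ℝ),
      IsClassicalNSSolutionOn (Ici 0) ν (fun _ => F) u p → (∀ t : ℝ, 0 ≤ t → rep (φ t x) =ᵐ[volume] u t) →
      ∀ t : ℝ, τ ≤ t → gradNormSq (laplacian (u t)) ≤ C := by
  have hτ2 : 0 < τ / 2 := half_pos hτ
  obtain ⟨E₁, hE₁⟩ := hK.exists_forall_gradNormSq_le
  obtain ⟨Y₁, hY₁⟩ := hK.exists_forall_integral_norm_laplacian_sq_le hν hτ2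
  obtain ⟨C, hC⟩ := IsClassicalNSSolutionOn.gradNormSq_laplacian_le_of_le (d := Fin 3) (Fintype.card_fin 3) hν
    E₁ Y₁ (gradNormSq F) (∫ y, ‖laplacian F y‖ ^ 2) hτ2
  refine ⟨C, fun x hx u p hsol hrep t ht => ?_⟩
  have ht0 : τ / 2 ≤ t - τ / 2 := by linarith
  have hsub : Icc (t - τ / 2) (t - τ / 2 + τ / 2) ⊆ Ici 0 := fun s hs => mem_Ici.2 (by linarith [hs.1])
  have hlt : t - τ / 2 < t - τ / 2 + τ / 2 := by linarith
  have hsol' : IsClassicalNSSolutionOn (Icc (t - τ / 2) (t - τ / 2 + τ / 2)) ν (fun _ => F) u p :=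
    hsol.mono hsub (uniqueDiffOn_Icc hlt)
  have h := hC hsol' (fun s hs => hasZeroMean_of_rep_ae_eq (φ s x) (hrep s (hsub hs)))
    (fun s hs => hE₁ x hx u p hsol hrep s (hsub hs)) (fun s hs => hY₁ x hx u p hsol hrep s (ht0.trans hs.1))
    (fun s _ => le_rfl) (fun s _ => le_rfl)
  rwa [sub_add_cancel] at h

/-- **Uniform `W^{1,∞}` bound along an NS phase after a time lapse**: for every `τ > 0` there is `M₁` with
`‖∂ₖu(t, y)‖ ≤ M₁` for every `x ∈ K`, every classical trajectory `(u, p)` of `x`, every `t ≥ τ`, every direction `k`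
and every `y ∈ T³` — the embedding `‖∂ₖu‖² ≤ K₀ (‖Δu‖₂² + ‖∇Δu‖₂²)` (`Torus.norm_partialDeriv_sq_le_of_isSmooth`) on
top of the uniform `H²` and `H³` bounds.  These are the coefficient bounds `‖∂ᵢu‖ ≤ Cᵢ` of the `H → V` smoothing
estimates of the linearised and difference equations and the `W^{1,∞}` bound of the `L²`-Lipschitz estimate
`Torus.IsClassicalNSSolutionOn.integral_norm_sub_sq_le_mul_exp`. [folklore] -/
theorem IsNSPhase.exists_forall_norm_partialDeriv_le (hν : 0 < ν) (hK : IsNSPhase ν F K φ) {τ : ℝ} (hτ : 0 < τ) :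
    ∃ M₁ : ℝ, ∀ x ∈ K, ∀ (u : ℝ → (UnitAddTorus (Fin 3)) → (EuclideanSpace ℝ (Fin 3))) (p : ℝ → (UnitAddTorus (Fin 3)) → ℝ),
      IsClassicalNSSolutionOn (Ici 0) ν (fun _ => F) u p → (∀ t : ℝ, 0 ≤ t → rep (φ t x) =ᵐ[volume] u t) →
      ∀ t : ℝ, τ ≤ t → ∀ (k : Fin 3) (y : UnitAddTorus (Fin 3)), ‖partialDeriv k (u t) y‖ ≤ M₁ := by
  obtain ⟨Y₁, hY₁⟩ := hK.exists_forall_integral_norm_laplacian_sq_le hν hτ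
  obtain ⟨C, hC⟩ := hK.exists_forall_gradNormSq_laplacian_le hν hτ
  obtain ⟨K₀, hK₀, hsup⟩ := norm_partialDeriv_sq_le_of_isSmooth (d := Fin 3) (Fintype.card_fin 3)
  refine ⟨Real.sqrt (K₀ * (Y₁ + C)), fun x hx u p hsol hrep t ht k y => ?_⟩
  have ht0 : 0 ≤ t := hτ.le.trans ht
  have hsm : IsSmooth (u t) := hsol.smooth_velocity.isSmooth_slice (mem_Ici.2 ht0)
  have h1 := hsup (u t) hsm k y
  have h2 := hY₁ x hx u p hsol hrep t ht
  have h3 := hC x hx u p hsol hrep t ht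
  rw [← Real.sqrt_sq (norm_nonneg (partialDeriv k (u t) y))]
  exact Real.sqrt_le_sqrt (h1.trans (mul_le_mul_of_nonneg_left (add_le_add h2 h3) hK₀.le))

/-- **Tools stub of block N1, `m = 3` (`stub_ergodicH3SmoothingTools`, crux stmt-AnomalousDissipation-1143, line
`ergodic-budget-selection-closing`)**: the conjunction of the two uniform bounds along an NS phase proved above — `H³`
smoothing and `W^{1,∞}` bounds on `φ_t(K)`, `t ≥ τ`. [folklore] -/
theorem stub_ergodicH3SmoothingTools : (∀ {ν : ℝ} {F : (UnitAddTorus (Fin 3)) → (EuclideanSpace ℝ (Fin 3))} {K : Set Hsp} {φ : ℝ → Hsp → Hsp}, 0 < ν → IsNSPhase ν F K φ → ∀ {τ : ℝ}, 0 < τ → ∃ C : ℝ, ∀ x ∈ K, ∀ (u : ℝ → (UnitAddTorus (Fin 3)) → (EuclideanSpace ℝ (Fin 3))) (p : ℝ → (UnitAddTorus (Fin 3)) → ℝ), IsClassicalNSSolutionOn (Ici 0) ν (fun _ => F) u p → (∀ t : ℝ, 0 ≤ t → rep (φ t x) =ᵐ[volume] u t) → ∀ t : ℝ, τ ≤ t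 → gradNormSq (laplacian (u t)) ≤ C) ∧ (∀ {ν : ℝ} {F : (UnitAddTorus (Fin 3)) → (EuclideanSpace ℝ (Fin 3))} {K : Set Hsp} {φ : ℝ → Hsp → Hsp}, 0 < ν → IsNSPhase ν F K φ → ∀ {τ : ℝ}, 0 < τ → ∃ M₁ : ℝ, ∀ x ∈ K, ∀ (u : ℝ → (UnitAddTorus (Fin 3)) → (EuclideanSpace ℝ (Fin 3))) (p : ℝ → (UnitAddTorus (Fin 3)) → ℝ), IsClassicalNSSolutionOn (Ici 0) ν (fun _ => F) u p → (∀ t : ℝ, 0 ≤ t → rep (φ t x) =ᵐ[volume] u t) → ∀ t : ℝ, τ ≤ t → ∀ (k : Fin 3) (y : UnitAddTorus (Fin 3)), ‖partialDeriv k (u t) y‖ ≤ M₁) :=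
  ⟨fun hν hK _ hτ => IsNSPhase.exists_forall_gradNormSq_laplacian_le hν hK hτ,
    fun hν hK _ hτ => IsNSPhase.exists_forall_norm_partialDeriv_le hν hK hτ⟩

end Summit.AnomalousDissipation.AnomalousDissipation.Theorems.DenseLoudDesignerForces.Ergodic

end
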